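import Mathlib
import Summits.Ventures.LatticeQCDFlow.Scaling.TiltedJet

/-!
# LatticeQCDFlow / Scaling — the covariance jet from fourteen moments
# (the polynomial identity behind (LC) at separation one: `β⁴/32 + O(β⁵)`, `λ`-free)

HONEST FRAMING: exact (Metropolis-corrected) sampling algorithms for lattice gauge theory;
figures of merit are autocorrelation/cost numbers at stated couplings and volumes; no
continuum-physics claim.

Venture `LatticeQCDFlow` (cell pub-lqcd), topic `Scaling`, FANOUT row 30 (lean-1) — OUR WORK, the
sequel of `Scaling/TiltedJet.lean` (tilted integrals `tilt ν C F β = ∫ F e^{βC} dν` and their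
Taylor jets).  THE COVARIANCE JET LEMMA `cov_jetEq_of_moments`: for bounded real `X, Y, C` on a
probability space whose moments take the values `∫C = 0`, `∫C² = 1 + λ`, `∫X = 0`, `∫XC = 1/2`,
`∫XC² = 0`, `∫XC³ = 9/8 + 3λ/2` (same for `Y`), `∫XY = ∫XYC = 0`, `∫XYC² = 1/2`, `∫XYC³ = 0`,
`∫XYC⁴ = 9/4 + 3λ` (ANY real `λ`; the moments `∫C³`, `∫C⁴`, `∫XC⁴`, `∫YC⁴` are free), the tilted
covariance `⟨XY⟩_β − ⟨X⟩_β⟨Y⟩_β` (`⟨F⟩_β = ∫F e^{βC} / ∫ e^{βC}`) equals `β⁴/32 + O(β⁵)` at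
`β = 0` (`cov_poly_identity`: the coefficients of `β⁰, …, β³` of `P_{XY}P₁ − P_XP_Y` vanish and
the `β⁴` coefficient is `1/32`, `λ` cancelling identically; the remainder is the explicit
polynomial `covRemainder`).  These are exactly the moment values of two parallel `U(1)` plaquette
cosines one lattice unit apart under product Haar measure, `C` the total plaquette cosine of the
torus (`λ = (#plaquettes − 2)/2`; the lattice half is the successor file), and `1/32 = 2^{-(4t+1)}`
at `t = 1` is the printed leading coefficient of the strong-coupling series of the
plaquette–plaquette correlation [cite: MontvayMunster1994, §3.6.2 (3.437)].
Elementary (jet algebra of the tree's `JetEq` + one `ring` identity); nothing is cited as a fact;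
one `def` (`covRemainder`), no `sorry`.
-/

noncomputable section

open MeasureTheory Filter Topology Asymptotics Finset
open Literature.MathematicalPhysics.QuantumFieldTheory (JetEq BddAt)

namespace Summit.Ventures.LatticeQCDFlow.Theory2.Tilted

variable {Ω : Type*} [MeasurableSpace Ω]

/-- Differences of jets. [folklore] -/
theorem jetEq_sub {n : ℕ} {f g f' g' : ℂ → ℂ} (h1 : JetEq n f f') (h2 : JetEq n g g') :
    JetEq n (fun β => f β - g β) (fun β => f' β - g' β) :=
  (Asymptotics.IsBigO.sub h1 h2).congr_left fun β => by ring

section Cov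

variable {ν : Measure Ω} [IsProbabilityMeasure ν] {X Y C : Ω → ℝ} {BX BY M : ℝ}

/-- The remainder polynomial of the covariance jet (coefficients in the free moments). [folklore] -/
def covRemainder (lam m13 m14 mX4 mY4 β : ℂ) : ℂ :=
  (-mY4 / 48 - mX4 / 48 + m13 / 24) + (-5 / 256 + m14 / 96 - lam / 64) * β +
    (-mY4 / 128 - mX4 / 128 + m13 / 192 - lam * mY4 / 96 - lam * mX4 / 96 + lam * m13 / 48) * β ^ 2 +
    (-1 / 128 - mX4 * mY4 / 576 + m14 / 768 - lam / 64 + lam * m14 / 192 - lam ^ 2 / 128) * β ^ 3 +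
    (-m13 / 192 - lam * m13 / 192) * β ^ 4 +
    (-m14 / 768 - m13 ^ 2 / 1152 - lam * m14 / 768) * β ^ 5 +
    (-m13 * m14 / 2304) * β ^ 6 + (-m14 ^ 2 / 18432) * β ^ 7

/-- **The polynomial identity behind (LC) at separation one**: with
`P₁ = 1 + (1+λ)β²/2 + m₁₃β³/6 + m₁₄β⁴/24`, `P_X = β/2 + (9/8+3λ/2)β³/6 + m_{X4}β⁴/24`,
`P_Y` likewise, `P_{XY} = β²/4 + (9/4+3λ)β⁴/24`:
`P_{XY}P₁ − P_XP_Y − (β⁴/32)P₁² = β⁵ · R(β)` — the coefficients of `β⁰…β⁴` cancel and `λ` drops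
out of the `β⁴` coefficient. [folklore] -/
theorem cov_poly_identity (lam m13 m14 mX4 mY4 β : ℂ) :
    (β ^ 2 / 4 + β ^ 4 / 24 * (9 / 4 + 3 * lam)) *
          (1 + β ^ 2 / 2 * (1 + lam) + β ^ 3 / 6 * m13 + β ^ 4 / 24 * m14) -
        (β / 2 + β ^ 3 / 6 * (9 / 8 + 3 / 2 * lam) + β ^ 4 / 24 * mX4) *
          (β / 2 + β ^ 3 / 6 * (9 / 8 + 3 / 2 * lam) + β ^ 4 / 24 * mY4) -
        β ^ 4 / 32 * (1 + β ^ 2 / 2 * (1 + lam) + β ^ 3 / 6 * m13 + β ^ 4 / 24 * m14) ^ 2 =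
      β ^ 5 * covRemainder lam m13 m14 mX4 mY4 β := by
  unfold covRemainder
  ring

/-- The remainder polynomial is continuous in the coupling. [folklore] -/
theorem continuous_covRemainder (lam m13 m14 mX4 mY4 : ℂ) :
    Continuous (covRemainder lam m13 m14 mX4 mY4) := by
  unfold covRemainder
  fun_prop

/-- **THE COVARIANCE JET LEMMA.**  Bounded real `X, Y, C` on a probability space with the fourteen
moment values of two parallel plaquette cosines at separation one (`C` the total cosine, `λ` free):
the tilted covariance `⟨XY⟩_β − ⟨X⟩_β⟨Y⟩_β`, `⟨F⟩_β = ∫F e^{βC}/∫e^{βC}`, is `β⁴/32 + O(β⁵)` at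
`β = 0`. [folklore] -/
theorem cov_jetEq_of_moments (hXm : Measurable X) (hYm : Measurable Y) (hCm : Measurable C)
    (hXb : ∀ ω, |X ω| ≤ BX) (hYb : ∀ ω, |Y ω| ≤ BY) (hCb : ∀ ω, |C ω| ≤ M) (hM : 0 ≤ M)
    {lam : ℝ} (hC1 : ∫ ω, C ω ∂ν = 0) (hC2 : ∫ ω, C ω ^ 2 ∂ν = 1 + lam)
    (hX0 : ∫ ω, X ω ∂ν = 0) (hX1 : ∫ ω, X ω * C ω ∂ν = 1 / 2) (hX2 : ∫ ω, X ω * C ω ^ 2 ∂ν = 0)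
    (hX3 : ∫ ω, X ω * C ω ^ 3 ∂ν = 9 / 8 + 3 / 2 * lam)
    (hY0 : ∫ ω, Y ω ∂ν = 0) (hY1 : ∫ ω, Y ω * C ω ∂ν = 1 / 2) (hY2 : ∫ ω, Y ω * C ω ^ 2 ∂ν = 0)
    (hY3 : ∫ ω, Y ω * C ω ^ 3 ∂ν = 9 / 8 + 3 / 2 * lam)
    (hXY0 : ∫ ω, X ω * Y ω ∂ν = 0) (hXY1 : ∫ ω, X ω * Y ω * C ω ∂ν = 0)
    (hXY2 : ∫ ω, X ω * Y ω * C ω ^ 2 ∂ν = 1 / 2) (hXY3 : ∫ ω, X ω * Y ω * C ω ^ 3 ∂ν = 0)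
    (hXY4 : ∫ ω, X ω * Y ω * C ω ^ 4 ∂ν = 9 / 4 + 3 * lam) :
    JetEq 5
      (fun β => tilt ν C (fun ω => ((X ω * Y ω : ℝ) : ℂ)) β / tilt ν C (fun _ => 1) β -
        tilt ν C (fun ω => (X ω : ℂ)) β / tilt ν C (fun _ => 1) β *
          (tilt ν C (fun ω => (Y ω : ℂ)) β / tilt ν C (fun _ => 1) β))
      (fun β => β ^ 4 / 32) := by
  -- bounds and measurability of the complexified observables
  have hB1 : ∀ ω : Ω, ‖(fun _ : Ω => (1 : ℂ)) ω‖ ≤ 1 := fun _ => by simp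
  have hBX : ∀ ω, ‖(X ω : ℂ)‖ ≤ BX := fun ω => by
    rw [Complex.norm_real, Real.norm_eq_abs]; exact hXb ω
  have hBY : ∀ ω, ‖(Y ω : ℂ)‖ ≤ BY := fun ω => by
    rw [Complex.norm_real, Real.norm_eq_abs]; exact hYb ω
  have hBX0 : 0 ≤ BX := (abs_nonneg _).trans (hXb (Classical.choice (by
    by_contra h
    rw [not_nonempty_iff] at h
    have := IsProbabilityMeasure.measure_univ (μ := ν)
    rw [Set.univ_eq_empty_iff.2 h, measure_empty] at this
    exact zero_ne_one this)))
  have hBXY : ∀ ω, ‖((X ω * Y ω : ℝ) : ℂ)‖ ≤ BX * BY := fun ω => by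
    rw [Complex.norm_real, Real.norm_eq_abs, abs_mul]
    exact mul_le_mul (hXb ω) (hYb ω) (abs_nonneg _) hBX0
  have hm1 : Measurable fun _ : Ω => (1 : ℂ) := measurable_const
  have hmX : Measurable fun ω => (X ω : ℂ) := Complex.measurable_ofReal.comp hXm
  have hmY : Measurable fun ω => (Y ω : ℂ) := Complex.measurable_ofReal.comp hYm
  have hmXY : Measurable fun ω => ((X ω * Y ω : ℝ) : ℂ) :=
    Complex.measurable_ofReal.comp (hXm.mul hYm)
  have h5 : 0 < 5 := by norm_num
  -- the four jets
  have j1 := tilt_jetEq (ν := ν) hCm hCb hM hm1 hB1 h5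
  have jX := tilt_jetEq (ν := ν) hCm hCb hM hmX hBX h5
  have jY := tilt_jetEq (ν := ν) hCm hCb hM hmY hBY h5
  have jXY := tilt_jetEq (ν := ν) hCm hCb hM hmXY hBXY h5
  -- the moment values, as complex numbers
  have c10 : cmoment ν C (fun _ => (1 : ℂ)) 0 = 1 := cmoment_one_zero
  have c11 : cmoment ν C (fun _ => (1 : ℂ)) 1 = 0 := by
    rw [cmoment_one]; simp [hC1]
  have c12 : cmoment ν C (fun _ => (1 : ℂ)) 2 = (1 + lam : ℝ) := by
    rw [cmoment_one, hC2]
  have cX0 : cmoment ν C (fun ω => (X ω : ℂ)) 0 = 0 := by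
    rw [cmoment_ofReal]; simp [hX0]
  have cX1 : cmoment ν C (fun ω => (X ω : ℂ)) 1 = (1 / 2 : ℝ) := by
    rw [cmoment_ofReal]; simp [hX1]
  have cX2 : cmoment ν C (fun ω => (X ω : ℂ)) 2 = 0 := by
    rw [cmoment_ofReal, hX2]; simp
  have cX3 : cmoment ν C (fun ω => (X ω : ℂ)) 3 = (9 / 8 + 3 / 2 * lam : ℝ) := by
    rw [cmoment_ofReal, hX3]
  have cY0 : cmoment ν C (fun ω => (Y ω : ℂ)) 0 = 0 := by
    rw [cmoment_ofReal]; simp [hY0]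
  have cY1 : cmoment ν C (fun ω => (Y ω : ℂ)) 1 = (1 / 2 : ℝ) := by
    rw [cmoment_ofReal]; simp [hY1]
  have cY2 : cmoment ν C (fun ω => (Y ω : ℂ)) 2 = 0 := by
    rw [cmoment_ofReal, hY2]; simp
  have cY3 : cmoment ν C (fun ω => (Y ω : ℂ)) 3 = (9 / 8 + 3 / 2 * lam : ℝ) := by
    rw [cmoment_ofReal, hY3]
  have cXY0 : cmoment ν C (fun ω => ((X ω * Y ω : ℝ) : ℂ)) 0 = 0 := by
    rw [cmoment_ofReal]; simp [hXY0]
  have cXY1 : cmoment ν C (fun ω => ((X ω * Y ω : ℝ) : ℂ)) 1 = 0 := by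
    rw [cmoment_ofReal]; simp [hXY1]
  have cXY2 : cmoment ν C (fun ω => ((X ω * Y ω : ℝ) : ℂ)) 2 = (1 / 2 : ℝ) := by
    rw [cmoment_ofReal, hXY2]
  have cXY3 : cmoment ν C (fun ω => ((X ω * Y ω : ℝ) : ℂ)) 3 = 0 := by
    rw [cmoment_ofReal, hXY3]; simp
  have cXY4 : cmoment ν C (fun ω => ((X ω * Y ω : ℝ) : ℂ)) 4 = (9 / 4 + 3 * lam : ℝ) := by
    rw [cmoment_ofReal, hXY4]
  -- names for the free moments and the four Taylor polynomials
  set m13 : ℂ := cmoment ν C (fun _ => (1 : ℂ)) 3 with hm13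
  set m14 : ℂ := cmoment ν C (fun _ => (1 : ℂ)) 4 with hm14
  set mX4 : ℂ := cmoment ν C (fun ω => (X ω : ℂ)) 4 with hmX4
  set mY4 : ℂ := cmoment ν C (fun ω => (Y ω : ℂ)) 4 with hmY4
  set P1 := tiltPoly ν C (fun _ => (1 : ℂ)) 5 with hP1def
  set PX := tiltPoly ν C (fun ω => (X ω : ℂ)) 5 with hPXdef
  set PY := tiltPoly ν C (fun ω => (Y ω : ℂ)) 5 with hPYdef
  set PXY := tiltPoly ν C (fun ω => ((X ω * Y ω : ℝ) : ℂ)) 5 with hPXYdef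
  have hfac : ∀ β : ℂ, ∀ c : ℕ → ℂ, (∑ i ∈ range 5, β ^ i / (i.factorial : ℂ) * c i) =
      c 0 + β * c 1 + β ^ 2 / 2 * c 2 + β ^ 3 / 6 * c 3 + β ^ 4 / 24 * c 4 := by
    intro β c
    simp only [Finset.sum_range_succ, Finset.sum_range_zero, Nat.factorial, Nat.succ_eq_add_one]
    push_cast
    ring
  have hP1 : ∀ β, P1 β = 1 + β ^ 2 / 2 * (1 + lam : ℂ) + β ^ 3 / 6 * m13 + β ^ 4 / 24 * m14 := by
    intro β
    rw [hP1def, tiltPoly, hfac β (cmoment ν C fun _ => (1 : ℂ)), c10, c11, c12]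
    push_cast; ring
  have hPX : ∀ β, PX β = β / 2 + β ^ 3 / 6 * (9 / 8 + 3 / 2 * lam : ℂ) + β ^ 4 / 24 * mX4 := by
    intro β
    rw [hPXdef, tiltPoly, hfac β (cmoment ν C fun ω => (X ω : ℂ)), cX0, cX1, cX2, cX3]
    push_cast; ring
  have hPY : ∀ β, PY β = β / 2 + β ^ 3 / 6 * (9 / 8 + 3 / 2 * lam : ℂ) + β ^ 4 / 24 * mY4 := by
    intro β
    rw [hPYdef, tiltPoly, hfac β (cmoment ν C fun ω => (Y ω : ℂ)), cY0, cY1, cY2, cY3]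
    push_cast; ring
  have hPXY : ∀ β, PXY β = β ^ 2 / 4 + β ^ 4 / 24 * (9 / 4 + 3 * lam : ℂ) := by
    intro β
    rw [hPXYdef, tiltPoly, hfac β (cmoment ν C fun ω => ((X ω * Y ω : ℝ) : ℂ)), cXY0, cXY1, cXY2,
      cXY3, cXY4]
    push_cast; ring
  -- boundedness / non-vanishing facts
  have hP10 : P1 0 = 1 := by rw [hP1]; simp
  obtain ⟨hP1ne, hP1inv⟩ :=
    eventually_ne_zero_and_bddAt_inv_of_continuous (continuous_tiltPoly (ν := ν)
      (C := C) (F := fun _ => (1 : ℂ)) 5) hP10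
  have hT1ne := eventually_tilt_one_ne_zero (ν := ν) hCm hCb hM
  have hT1inv := bddAt_inv_tilt_one (ν := ν) hCm hCb hM
  have bP1 : BddAt P1 := bddAt_of_continuous (continuous_tiltPoly 5)
  have bPX : BddAt PX := bddAt_of_continuous (continuous_tiltPoly 5)
  have bPXY : BddAt PXY := bddAt_of_continuous (continuous_tiltPoly 5)
  have bTY : BddAt (tilt ν C fun ω => (Y ω : ℂ)) := bddAt_tilt hCb hM hBY
  -- jet algebra: the covariance has the jet of the rational function of the polynomials
  have jI : JetEq 5 (fun β => (tilt ν C (fun _ => (1 : ℂ)) β)⁻¹) (fun β => (P1 β)⁻¹) :=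
    JetEq.inv j1 hT1inv hP1inv hT1ne hP1ne
  have jA : JetEq 5 (fun β => tilt ν C (fun ω => ((X ω * Y ω : ℝ) : ℂ)) β *
      (tilt ν C (fun _ => (1 : ℂ)) β)⁻¹) (fun β => PXY β * (P1 β)⁻¹) :=
    JetEq.mul jXY jI bPXY hT1inv
  have jB : JetEq 5 (fun β => tilt ν C (fun ω => (X ω : ℂ)) β * (tilt ν C (fun _ => (1 : ℂ)) β)⁻¹)
      (fun β => PX β * (P1 β)⁻¹) :=
    JetEq.mul jX jI bPX hT1inv
  have jC : JetEq 5 (fun β => tilt ν C (fun ω => (Y ω : ℂ)) β * (tilt ν C (fun _ => (1 : ℂ)) β)⁻¹)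
      (fun β => PY β * (P1 β)⁻¹) :=
    JetEq.mul jY jI (bddAt_of_continuous (continuous_tiltPoly 5)) hT1inv
  have jBC := JetEq.mul jB jC (bPX.mul hP1inv) (bTY.mul hT1inv)
  have jQ := jetEq_sub jA jBC
  -- the rational function of the polynomials is `β⁴/32 + O(β⁵)`
  have jR : JetEq 5 (fun β => PXY β * (P1 β)⁻¹ - PX β * (P1 β)⁻¹ * (PY β * (P1 β)⁻¹))
      (fun β => β ^ 4 / 32) := by
    have hev : (fun β => PXY β * (P1 β)⁻¹ - PX β * (P1 β)⁻¹ * (PY β * (P1 β)⁻¹) - β ^ 4 / 32)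
        =ᶠ[𝓝 (0 : ℂ)] fun β => β ^ 5 * (covRemainder (lam : ℂ) m13 m14 mX4 mY4 β *
          (P1 β)⁻¹ ^ 2) := by
      filter_upwards [hP1ne] with β hβ
      have hP : P1 β ≠ 0 := hβ
      have e : PXY β * (P1 β)⁻¹ - PX β * (P1 β)⁻¹ * (PY β * (P1 β)⁻¹) - β ^ 4 / 32 =
          (PXY β * P1 β - PX β * PY β - β ^ 4 / 32 * P1 β ^ 2) * (P1 β)⁻¹ ^ 2 := by
        field_simp
      rw [e, hPXY, hPX, hPY, hP1, cov_poly_identity]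
      ring
    have hbdd : BddAt fun β => covRemainder (lam : ℂ) m13 m14 mX4 mY4 β * (P1 β)⁻¹ ^ 2 := by
      have h2 : BddAt fun β => (P1 β)⁻¹ ^ 2 := by
        simpa [pow_two] using hP1inv.mul hP1inv
      exact (bddAt_of_continuous (continuous_covRemainder _ _ _ _ _)).mul h2
    have hO : (fun β => β ^ 5 * (covRemainder (lam : ℂ) m13 m14 mX4 mY4 β * (P1 β)⁻¹ ^ 2))
        =O[𝓝 (0 : ℂ)] fun β => β ^ 5 :=
      ((Asymptotics.isBigO_refl (fun β : ℂ => β ^ 5) _).mul hbdd).congr_right fun _ => by simp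
    exact hO.congr' hev.symm EventuallyEq.rfl
  -- conclude
  have hfun : (fun β => tilt ν C (fun ω => ((X ω * Y ω : ℝ) : ℂ)) β / tilt ν C (fun _ => 1) β -
        tilt ν C (fun ω => (X ω : ℂ)) β / tilt ν C (fun _ => 1) β *
          (tilt ν C (fun ω => (Y ω : ℂ)) β / tilt ν C (fun _ => 1) β)) =
      fun β => tilt ν C (fun ω => ((X ω * Y ω : ℝ) : ℂ)) β * (tilt ν C (fun _ => (1 : ℂ)) β)⁻¹ -
        tilt ν C (fun ω => (X ω : ℂ)) β * (tilt ν C (fun _ => (1 : ℂ)) β)⁻¹ *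
          (tilt ν C (fun ω => (Y ω : ℂ)) β * (tilt ν C (fun _ => (1 : ℂ)) β)⁻¹) := by
    funext β; simp only [div_eq_mul_inv]
  rw [hfun]
  exact jQ.trans jR

end Cov

end Summit.Ventures.LatticeQCDFlow.Theory2.Tilted

end
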